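import Mathlib

/-!
# Crux `LandauTail.LandauTailBlowup` (stmt-NavierStokesRegularity-1944), line `registered`, cycle c6:
  pointwise split of the very weak integrand (linear terms + quadratic defect)

Helper file on the proof path of the crux item `stmt-NavierStokesRegularity-1944`
(`Summit.NavierStokesRegularity.NavierStokesRegularity.Theses.LandauTail.LandauTailBlowup`), lead c6; serves the
registered support stub `landauTail_veryWeak_defect_le` (`LandauTailLandauTailBlowupDefectInequality.lean`).
With the very weak Navier–Stokes integrand `Φ(a) = ⟪a, d⟫ + ⟪a, D a⟫ + ν⟪a, L⟫` (test data `d = ∂ₜψ`, `D = ∇ψ`,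
`L = Δψ`) the exact identity
`Φ(a) − Φ(b) = ⟪a−b, d⟫ + ⟪a−b, D b⟫ + ⟪b, D(a−b)⟫ + ν⟪a−b, L⟫ + ⟪a−b, D(a−b)⟫`
isolates the QUADRATIC DEFECT `⟪a−b, D(a−b)⟫ ≤ ‖D‖ ‖a−b‖²` from terms linear in `a − b`.

* `landauTail_norm_veryWeakIntegrand_sub_le_defect` — real form;
* `landauTail_enorm_veryWeakIntegrand_sub_le_defect` — `ℝ≥0∞` form.
-/

set_option linter.dupNamespace false

noncomputable section

open scoped NNReal ENNReal RealInnerProductSpace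

namespace Summit.NavierStokesRegularity.NavierStokesRegularity.Theorems

section Pointwise

variable {F : Type*} [NormedAddCommGroup F] [InnerProductSpace ℝ F]

/-- **Pointwise split of the very weak integrand into linear terms and the quadratic defect.** With test data
`d`, `D`, `L` of norm `≤ M₀` and `‖D‖ ≤ M`, the integrand `Φ(a) = ⟪a, d⟫ + ⟪a, D a⟫ + ν⟪a, L⟫` satisfies
`|Φ(a) − Φ(b)| ≤ M₀(1+|ν|)‖a−b‖ + 2M₀‖b‖‖a−b‖ + M‖a−b‖²`
(`Φ(a) − Φ(b) = ⟪a−b, d⟫ + ⟪a−b, D b⟫ + ⟪b, D(a−b)⟫ + ν⟪a−b, L⟫ + ⟪a−b, D(a−b)⟫`). [folklore] -/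
theorem landauTail_norm_veryWeakIntegrand_sub_le_defect {a b d L : F} {D : F →L[ℝ] F} {M₀ M ν : ℝ}
    (h1 : ‖d‖ ≤ M₀) (h2 : ‖D‖ ≤ M₀) (h3 : ‖L‖ ≤ M₀) (h4 : ‖D‖ ≤ M) :
    ‖(⟪a, d⟫ + ⟪a, D a⟫ + ν * ⟪a, L⟫) - (⟪b, d⟫ + ⟪b, D b⟫ + ν * ⟪b, L⟫)‖ ≤
      M₀ * (1 + |ν|) * ‖a - b‖ + 2 * M₀ * (‖b‖ * ‖a - b‖) + M * (‖a - b‖ * ‖a - b‖) := by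
  have key : (⟪a, d⟫ + ⟪a, D a⟫ + ν * ⟪a, L⟫) - (⟪b, d⟫ + ⟪b, D b⟫ + ν * ⟪b, L⟫) =
      ⟪a - b, d⟫ + ⟪a - b, D b⟫ + ⟪b, D (a - b)⟫ + ν * ⟪a - b, L⟫ + ⟪a - b, D (a - b)⟫ := by
    simp only [inner_sub_left, map_sub, inner_sub_right]
    ring
  rw [key]
  have e1 : ‖⟪a - b, d⟫‖ ≤ ‖a - b‖ * M₀ :=
    (norm_inner_le_norm _ _).trans (mul_le_mul_of_nonneg_left h1 (norm_nonneg _))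
  have e2 : ‖⟪a - b, D b⟫‖ ≤ ‖a - b‖ * (M₀ * ‖b‖) := by
    refine (norm_inner_le_norm _ _).trans (mul_le_mul_of_nonneg_left ?_ (norm_nonneg _))
    exact (D.le_opNorm b).trans (mul_le_mul_of_nonneg_right h2 (norm_nonneg _))
  have e3 : ‖⟪b, D (a - b)⟫‖ ≤ ‖b‖ * (M₀ * ‖a - b‖) := by
    refine (norm_inner_le_norm _ _).trans (mul_le_mul_of_nonneg_left ?_ (norm_nonneg _))
    exact (D.le_opNorm _).trans (mul_le_mul_of_nonneg_right h2 (norm_nonneg _))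
  have e4 : ‖ν * ⟪a - b, L⟫‖ ≤ |ν| * (‖a - b‖ * M₀) := by
    rw [norm_mul, Real.norm_eq_abs]
    exact mul_le_mul_of_nonneg_left
      ((norm_inner_le_norm _ _).trans (mul_le_mul_of_nonneg_left h3 (norm_nonneg _))) (abs_nonneg _)
  have e5 : ‖⟪a - b, D (a - b)⟫‖ ≤ ‖a - b‖ * (M * ‖a - b‖) := by
    refine (norm_inner_le_norm _ _).trans (mul_le_mul_of_nonneg_left ?_ (norm_nonneg _))
    exact (D.le_opNorm _).trans (mul_le_mul_of_nonneg_right h4 (norm_nonneg _))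
  calc ‖⟪a - b, d⟫ + ⟪a - b, D b⟫ + ⟪b, D (a - b)⟫ + ν * ⟪a - b, L⟫ + ⟪a - b, D (a - b)⟫‖
      ≤ ‖⟪a - b, d⟫‖ + ‖⟪a - b, D b⟫‖ + ‖⟪b, D (a - b)⟫‖ + ‖ν * ⟪a - b, L⟫‖ + ‖⟪a - b, D (a - b)⟫‖ := by
        refine (norm_add_le _ _).trans (add_le_add ?_ le_rfl)
        refine (norm_add_le _ _).trans (add_le_add ?_ le_rfl)
        refine (norm_add_le _ _).trans (add_le_add ?_ le_rfl)
        exact norm_add_le _ _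
    _ ≤ ‖a - b‖ * M₀ + ‖a - b‖ * (M₀ * ‖b‖) + ‖b‖ * (M₀ * ‖a - b‖) + |ν| * (‖a - b‖ * M₀) +
        ‖a - b‖ * (M * ‖a - b‖) := add_le_add (add_le_add (add_le_add (add_le_add e1 e2) e3) e4) e5
    _ = M₀ * (1 + |ν|) * ‖a - b‖ + 2 * M₀ * (‖b‖ * ‖a - b‖) + M * (‖a - b‖ * ‖a - b‖) := by ring

/-- The `ℝ≥0∞` form of `landauTail_norm_veryWeakIntegrand_sub_le_defect` on `ℝ³` (registered support stub of
crux stmt-NavierStokesRegularity-1944, helper of `landauTail_veryWeak_defect_le`):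
`‖Φ(a) − Φ(b)‖ₑ ≤ M₀(1+|ν|)‖a−b‖ₑ + 2M₀‖b‖ₑ‖a−b‖ₑ + M‖a−b‖ₑ²`. [folklore] -/
theorem landauTail_enorm_veryWeakIntegrand_sub_le_defect : ∀ (a b d L : EuclideanSpace ℝ (Fin 3)) (D : EuclideanSpace ℝ (Fin 3) →L[ℝ] EuclideanSpace ℝ (Fin 3)) (M₀ M ν : ℝ), ‖d‖ ≤ M₀ → ‖D‖ ≤ M₀ → ‖L‖ ≤ M₀ → ‖D‖ ≤ M → ‖(inner ℝ a d + inner ℝ a (D a) + ν * inner ℝ a L) - (inner ℝ b d + inner ℝ b (D b) + ν * inner ℝ b L)‖ₑ ≤ ENNReal.ofReal (M₀ * (1 + |ν|)) * ‖a - b‖ₑ + ENNReal.ofReal (2 * M₀) * (‖b‖ₑ * ‖a - b‖ₑ) + ENNReal.ofReal M * ‖a - b‖ₑ ^ 2 := by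
  intro a b d L D M₀ M ν h1 h2 h3 h4
  have hM₀ : 0 ≤ M₀ := (norm_nonneg _).trans h1
  have hM : 0 ≤ M := (norm_nonneg _).trans h4
  have hν : 0 ≤ M₀ * (1 + |ν|) := by positivity
  have key := landauTail_norm_veryWeakIntegrand_sub_le_defect (a := a) (b := b) (ν := ν) h1 h2 h3 h4
  rw [← ofReal_norm, ← ofReal_norm (a - b), ← ofReal_norm b, sq, ← ENNReal.ofReal_mul hν,
    ← ENNReal.ofReal_mul (norm_nonneg _), ← ENNReal.ofReal_mul (by positivity),
    ← ENNReal.ofReal_mul (norm_nonneg _), ← ENNReal.ofReal_mul hM,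
    ← ENNReal.ofReal_add (by positivity) (by positivity), ← ENNReal.ofReal_add (by positivity) (by positivity)]
  exact ENNReal.ofReal_le_ofReal key

end Pointwise

end Summit.NavierStokesRegularity.NavierStokesRegularity.Theorems

end
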